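import Mathlib
import Summits.AnomalousDissipation.AnomalousDissipation.Theses.DyadicWallCascade

/-!
# Census signatures, redirect strategist r1 — crux `DyadicWallCascade.HalfSpaceHierarchy`
# (item stmt-AnomalousDissipation-18627)

Typed companions of `Cruxes/HalfSpaceHierarchy/STRATEGY-CENSUS-r1.md` (this seat).  Everything here is a
`def … : Prop` (statements only, no `sorry`); the one theorem proved here is bookkeeping
(`isCellJunction_iff_stub_body`-style repackaging is NOT needed: `IsCellJunction` below is, clause for clause, the
body of the registered residual stub `BernoulliSurfaceTopology.stub_cellJunction` / the hypothesis of the landed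
`Theorems.HalfSpaceHierarchy.stub_cellJunctionTransfer`, with the six existential witnesses turned into parameters).

* `IsCellJunction G PG U P F η` — cell-junction data.
* `IsColumnar G` — the collar state does not depend on `z` (every closed-form conduit array in the dossier:
  swirling coaxial jets `w(r)e₃ + v(r)e_θ`, parallel jets `w(x,y)e₃`, cellular arrays `(∇⊥χ, W(χ))`, tilted shears).
* `RegularNodal G` — `0` is a regular value of the vertical collar velocity `q ↦ G₃(q,2)` on `ℝ²`
  (so the descending set `{G₃ < 0}` and the ascending set `{G₃ > 0}` have finite topological type mod `ℤ²`).
* `ExitsTransversally U X` / `EntersTransversally U X` — the `U`-streamline through a point `X` of a section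
  (`z = 2` or `z = 1`) that moves INTO the cell leaves the open cell `{1 < z < 2}` again in finite time through a
  section point where `U₃ ≠ 0` (resp. the time-reversed statement for points moving OUT of the cell).
* `TwoWayTransientCell U` — every entering section point exits transversally and every exiting section point entered
  transversally: "no streamline of moving section fluid is trapped in the cell, forward or backward".
* `NoTransientColumnarJunction` — THE THEOREM of census §N-r1.1 (paper proof there; formalisation needs flows of
  smooth vector fields, covering degree on `T²` and Euler characteristic of open subsurfaces of `T²`, none of which is
  in Mathlib in usable form): a cell junction with columnar, regular-nodal collars is never two-way transient.
  Consequence spelled out in the census: every such junction carries a DIVIDING STREAMLINE of moving descending (or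
  ascending) section fluid whose limit set is a non-empty compact invariant set inside the closed cell — stagnation,
  a periodic streamline, or a non-trivially recurrent minimal set — so no "time-function" existence scheme
  (Lortz 1970, Alber 1992, Buffoni–Wahlén 2019, Lokharu–Seth–Wahlén 2020, Seth–Varholm–Wahlén 2024,
  Drivas–Elgindi–Ginsberg 2025) can produce it.
-/

namespace Summit.AnomalousDissipation.AnomalousDissipation.Cruxes.HalfSpaceHierarchy.CensusR1

open scoped BigOperators
open Set

/-- ambient space -/
abbrev E3 := EuclideanSpace ℝ (Fin 3)

/-- the point of `ℝ³` above `q ∈ ℝ²` at height `h` -/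
def pt (q : ℝ × ℝ) (h : ℝ) : E3 := !₂[q.1, q.2, h]

/-- **Cell-junction data** — verbatim the clause block of `stub_cellJunction` (registered residual stub of line
`bernoulli-surface-topology`) with its six existential witnesses as parameters: an entire smooth `ℤ²`-periodic
divergence-free steady Euler conduit array `(G, PG)` with zero mass flux and energy flux `F ≠ 0` through
`[0,1]² × {0}`, a collar width `0 < η < 1/2`, and a smooth cell solution `(U, P)` on `{1-η < z < 2+η}`, divergence
free and steady Euler on the open band, `ℤ²`-periodic on the closed band, equal to `(G, PG)` on the top collar and
to `(G, PG) ∘ (2•)` on the bottom collar. -/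
def IsCellJunction (G : E3 → E3) (PG : E3 → ℝ) (U : E3 → E3) (P : E3 → ℝ) (F η : ℝ) : Prop :=
  ContDiff ℝ ((⊤ : ℕ∞) : WithTop ℕ∞) G ∧ ContDiff ℝ ((⊤ : ℕ∞) : WithTop ℕ∞) PG ∧
  (∀ X : E3, ∑ i : Fin 3, (fderiv ℝ G X (EuclideanSpace.single i (1 : ℝ))) i = 0) ∧
  (∀ X : E3, (fderiv ℝ G X) (G X) + gradient PG X = 0) ∧
  (∀ X : E3,
    G (X + EuclideanSpace.single 0 (1 : ℝ)) = G X ∧ G (X + EuclideanSpace.single 1 (1 : ℝ)) = G X ∧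
    PG (X + EuclideanSpace.single 0 (1 : ℝ)) = PG X ∧ PG (X + EuclideanSpace.single 1 (1 : ℝ)) = PG X) ∧
  (∫ q in Set.Icc (0 : ℝ) 1 ×ˢ Set.Icc (0 : ℝ) 1, (G !₂[q.1, q.2, (0 : ℝ)]) 2 = 0) ∧ F ≠ 0 ∧
  (∫ q in Set.Icc (0 : ℝ) 1 ×ˢ Set.Icc (0 : ℝ) 1,
    (G !₂[q.1, q.2, (0 : ℝ)]) 2 * (‖G !₂[q.1, q.2, (0 : ℝ)]‖ ^ 2 / 2 + PG !₂[q.1, q.2, (0 : ℝ)]) = F) ∧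
  0 < η ∧ η < 1 / 2 ∧
  ContDiffOn ℝ ((⊤ : ℕ∞) : WithTop ℕ∞) U {Y : E3 | 1 - η < Y 2 ∧ Y 2 < 2 + η} ∧
  ContDiffOn ℝ ((⊤ : ℕ∞) : WithTop ℕ∞) P {Y : E3 | 1 - η < Y 2 ∧ Y 2 < 2 + η} ∧
  (∀ X : E3, 1 < X 2 → X 2 < 2 → ∑ i : Fin 3, (fderiv ℝ U X (EuclideanSpace.single i (1 : ℝ))) i = 0) ∧
  (∀ X : E3, 1 < X 2 → X 2 < 2 → (fderiv ℝ U X) (U X) + gradient P X = 0) ∧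
  (∀ X : E3, 1 ≤ X 2 → X 2 ≤ 2 →
    U (X + EuclideanSpace.single 0 (1 : ℝ)) = U X ∧ U (X + EuclideanSpace.single 1 (1 : ℝ)) = U X ∧
    P (X + EuclideanSpace.single 0 (1 : ℝ)) = P X ∧ P (X + EuclideanSpace.single 1 (1 : ℝ)) = P X) ∧
  (∀ X : E3, 2 - η < X 2 → X 2 < 2 + η → U X = G X ∧ P X = PG X) ∧
  (∀ X : E3, 1 - η < X 2 → X 2 < 1 + η → U X = G ((2 : ℝ) • X) ∧ P X = PG ((2 : ℝ) • X))

/-- **Columnar collars**: the conduit array does not depend on the vertical coordinate. -/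
def IsColumnar (G : E3 → E3) : Prop :=
  ∀ (X : E3) (s : ℝ), G (X + s • EuclideanSpace.single 2 (1 : ℝ)) = G X

/-- the vertical collar velocity as a function on the plane (height `2`, the middle of the top collar) -/
def vert (G : E3 → E3) (q : ℝ × ℝ) : ℝ := (G (pt q 2)) 2

/-- **Regular nodal set**: `0` is a regular value of `q ↦ G₃(q, 2)` on `ℝ²`.  With periodicity this makes the nodal
set a compact 1-manifold in `T²` (finitely many circles), so `{G₃ < 0}` and `{G₃ > 0}` are open subsurfaces of `T²`
of finite topological type — the finiteness the covering argument of §N-r1.1 needs. -/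
def RegularNodal (G : E3 → E3) : Prop :=
  ∀ q : ℝ × ℝ, vert G q = 0 → fderiv ℝ (vert G) q ≠ 0

/-- The `U`-streamline from the section point `X` runs inside the open cell `{1 < z < 2}` for `0 < t < T` and
leaves it at time `T` through a section point where the vertical velocity does not vanish (down through `z = 1`
with `U₃ < 0`, or up through `z = 2` with `U₃ > 0`). -/
def ExitsTransversally (U : E3 → E3) (X : E3) : Prop :=
  ∃ T : ℝ, 0 < T ∧ ∃ γ : ℝ → E3, γ 0 = X ∧
    (∀ t ∈ Set.Icc (0 : ℝ) T, HasDerivAt γ (U (γ t)) t) ∧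
    (∀ t ∈ Set.Ioo (0 : ℝ) T, 1 < (γ t) 2 ∧ (γ t) 2 < 2) ∧
    (((γ T) 2 = 1 ∧ (U (γ T)) 2 < 0) ∨ ((γ T) 2 = 2 ∧ 0 < (U (γ T)) 2))

/-- Time-reversed companion: the `U`-streamline arriving at the section point `X` was inside the open cell for
`-T < t < 0` and entered it at time `-T` through a section point with non-vanishing vertical velocity (down through
`z = 2` with `U₃ < 0`, or up through `z = 1` with `U₃ > 0`). -/
def EntersTransversally (U : E3 → E3) (X : E3) : Prop :=
  ∃ T : ℝ, 0 < T ∧ ∃ γ : ℝ → E3, γ 0 = X ∧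
    (∀ t ∈ Set.Icc (-T) (0 : ℝ), HasDerivAt γ (U (γ t)) t) ∧
    (∀ t ∈ Set.Ioo (-T) (0 : ℝ), 1 < (γ t) 2 ∧ (γ t) 2 < 2) ∧
    (((γ (-T)) 2 = 2 ∧ (U (γ (-T))) 2 < 0) ∨ ((γ (-T)) 2 = 1 ∧ 0 < (U (γ (-T))) 2))

/-- **Two-way transience of the cell**: every section point whose fluid moves INTO the cell (top with `U₃ < 0`,
bottom with `U₃ > 0`) exits transversally in finite time, and every section point whose fluid moves OUT of the cell
(top with `U₃ > 0`, bottom with `U₃ < 0`) entered transversally a finite time ago.  (Section points with `U₃ = 0`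
lie on the invariant nodal cylinders of the exact collars and are not constrained; interior rest fluid is not
constrained either — only MOVING SECTION FLUID.)  This is exactly the standing hypothesis of every transit-type
existence scheme (bounded residence time, data carried in from a section). -/
def TwoWayTransientCell (U : E3 → E3) : Prop :=
  (∀ X : E3, ((X 2 = 2 ∧ (U X) 2 < 0) ∨ (X 2 = 1 ∧ 0 < (U X) 2)) → ExitsTransversally U X) ∧
  (∀ X : E3, ((X 2 = 2 ∧ 0 < (U X) 2) ∨ (X 2 = 1 ∧ (U X) 2 < 0)) → EntersTransversally U X)

/-- **THEOREM (census §N-r1.1, paper proof; statement only).**  No cell junction with columnar, regular-nodal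
collars is two-way transient.  Proof sketch (census): `G₃` is a first integral of a columnar entire periodic steady
Euler flow (`G·∇G₃ = 0`, from bounded periodic pressure), so the descending / ascending / nodal cylinders are
invariant in the collars and the nodal ones cannot be entered (flat matching + ODE uniqueness); under two-way
transience every component of the descending set mod `ℤ²` is wholly through-going or wholly returning, the
through-map is a flux-preserving homeomorphism onto whole components of the half-scale descending set
(`≅` the 4-fold cover `ℝ²/2ℤ² → ℝ²/ℤ²` restricted), `F ≠ 0` plus incompressibility (pairing of section crossings,
volume balance in slabs) give a positive-flux family of wall-bound streamlines with deterministic component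
itineraries, whose record components are homeomorphic connected covers of one finite-type type-surface `S ⊂ T²`
of unboundedly growing degree — so `χ(S) = 0`, `S = T²`, contradicting zero mass flux. -/
def NoTransientColumnarJunction : Prop :=
  ∀ (G : E3 → E3) (PG : E3 → ℝ) (U : E3 → E3) (P : E3 → ℝ) (F η : ℝ),
    IsCellJunction G PG U P F η → IsColumnar G → RegularNodal G → ¬ TwoWayTransientCell U

/-- **Corollary shape used in the census (statement only): the dividing streamline.**  Under the same hypotheses
some MOVING section point is trapped: its forward streamline stays in the open cell for all positive time it
exists on, or its backward streamline does — i.e. it accumulates on a non-empty compact invariant set of the closed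
cell (stagnation point, periodic streamline, or recurrent minimal set; Birkhoff).  Logically this is just
`¬ TwoWayTransientCell` unfolded; it is recorded separately because it is the form in which the obstruction meets
the literature ("no global time function", census §T-r1). -/
def HasTrappedSectionStreamline (U : E3 → E3) : Prop :=
  (∃ X : E3, ((X 2 = 2 ∧ (U X) 2 < 0) ∨ (X 2 = 1 ∧ 0 < (U X) 2)) ∧ ¬ ExitsTransversally U X) ∨
  (∃ X : E3, ((X 2 = 2 ∧ 0 < (U X) 2) ∨ (X 2 = 1 ∧ (U X) 2 < 0)) ∧ ¬ EntersTransversally U X)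

theorem hasTrapped_iff_not_twoWay (U : E3 → E3) :
    HasTrappedSectionStreamline U ↔ ¬ TwoWayTransientCell U := by
  unfold HasTrappedSectionStreamline TwoWayTransientCell
  constructor
  · rintro (⟨X, hX, hn⟩ | ⟨X, hX, hn⟩) ⟨h1, h2⟩
    · exact hn (h1 X hX)
    · exact hn (h2 X hX)
  · intro h
    by_contra hc
    simp only [not_or, not_exists, not_and, not_not] at hc
    exact h ⟨fun X hX => hc.1 X hX, fun X hX => hc.2 X hX⟩

/-- **S⁺ (r1) `TransientJunctionHierarchy`** — the strengthening "crux witnessed by a two-way transient columnar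
cell junction".  By `NoTransientColumnarJunction` it is EMPTY; recorded as the typed form of census §S-r1.1
("the only rigid form that hands us an engine — transience — is provably empty in the columnar-collar class"). -/
def TransientJunctionHierarchy : Prop :=
  ∃ (G : E3 → E3) (PG : E3 → ℝ) (U : E3 → E3) (P : E3 → ℝ) (F η : ℝ),
    IsCellJunction G PG U P F η ∧ IsColumnar G ∧ RegularNodal G ∧ TwoWayTransientCell U

theorem transientJunctionHierarchy_false_of (h : NoTransientColumnarJunction) : ¬ TransientJunctionHierarchy := by
  rintro ⟨G, PG, U, P, F, η, hJ, hC, hR, hT⟩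
  exact h G PG U P F η hJ hC hR hT

end Summit.AnomalousDissipation.AnomalousDissipation.Cruxes.HalfSpaceHierarchy.CensusR1
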